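import Summits.Ventures.CertifiedManyBodySolver.Downfold.RouterWordScoreAgF2Typing

/-!
# The organic LATTICE TRIPLE «1BH ∣ 1BH+UND:LATTICE ∣ UND:LATTICE» in closed form for the §4.2 score
# (seat hubbard-downfold-score-2 gen 23; companion of `RouterWordScoreSingletonTypings.lean` p750409 and
# `RouterWordScoreRedundantAlternatives.lean` p744404; filed BEFORE the (ET)₂I₃ records M209 / M210 / M211 are stamped)

Venture CertifiedManyBodySolver, cell `pub/hubbard-downfold`; namespace `Summit.Ventures.CertifiedManyBodySolver.Downfold.RouterScore`.
Everything here is PROVED (no `sorry`, standard axioms); nothing here is physics.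

The κ-phase organics and the (ET)₂I₃ polymorph set (VSET rows M28 / M46 / M65 / M120 / M129 κ-(ET)₂X; M209 α-, M210 β_L-, M211 β_H-,
M212 θ-, M213 κ-(ET)₂I₃; lead R-cy = R20w, run-8 g17 PREREG + CLAIM 2026-08-30T23:33Z, lead g38 RULING R-aav) carry the typed
expectation `['1BH', '1BH+UND:LATTICE', 'UND:LATTICE']` — the LATTICE TRIPLE. Its middle word has the primary of the first and more
tokens, i.e. it is DOMINATED by «1BH» (`Dominates`, p744404), so by `outcome_append_redundant` the triple scores every print exactly
like the TWO BARE PRIMARIES «1BH ∣ UND:LATTICE» (`score_latticeTriple_eq_pair`).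

* §1 (any head alphabet) TWO ONE-TOKEN ALTERNATIVES IN CLOSED FORM — `outcome_two_singletons`: against `[[q₁], [q₂]]` (both
  non-structural) a print `p :: tl` scores structural-led ⇒ `ABSTAIN_structure` · `p = q₁ ∨ p = q₂` ⇒ `AGREE` (whatever rides) ·
  otherwise `PARTIAL` iff `q₁` or `q₂` rides, else `DISAGREE`. (The MIXPAIR closed form of p744404 is the instance `q₁ = UND:MIXED`,
  `q₂ = UND:MULTIORB`; here it is proved once for all pairs.)
* §2 the LATTICE TRIPLE: the collapse (`score_latticeTriple_eq_pair`), the closed form (`score_latticeTriple`), `AGREE` iff LED by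
  «1BH» or «UND:LATTICE» (`latticeTriple_agree_iff`), and RIDERS ARE SCORE-INERT BEHIND «1BH» (`latticeTriple_bh1_led`): a «CI»
  rider that fires on one conformer and not on the other (run-8 g17's β-(ET)₂I₃ «ROUTER-SENSITIVE(conformer) on the rider only»,
  2026-08-30T23:59Z) cannot move the verdict.
* §3 the instances quoted in score-2's block54 registration (2026-08-30T23:39Z, router_score.py `7c674b4bf285cdbe`) and the κ-lane
  precedents of record (M120 «1BH», M46 «1BH+CI», M213 «1BH» — all AGREE) by `decide`.

WHAT THIS IS NOT: not a statement about any organic conductor, not a typing ruling (the words are the curators' and the lead's) and not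
the scorer of record (deputy-2 score.py / score-1 phasemap are) — the kernel form of what the §4.2 letter can and cannot tell apart on
this typing, so that «AGREE-class ×2, head invariant, rider conformer-sensitive» is a mechanical sentence.
-/

namespace Summit.Ventures.CertifiedManyBodySolver.Downfold

namespace RouterScore

/-! ## §1 Two one-token alternatives, closed form (any head alphabet) -/

section general

variable {α : Type*} [DecidableEq α] (structural : α → Bool)

omit [DecidableEq α] in
/-- two one-token alternatives led by non-structural heads expect no structural primary. [folklore] -/
theorem expectsStructural_two_singletons {q₁ q₂ : α} (h₁ : structural q₁ = false) (h₂ : structural q₂ = false) :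
    expectsStructural structural [[q₁], [q₂]] = false := by
  simp [expectsStructural, h₁, h₂]

/-- a one-token word fully matches iff the print is led by its head. [folklore] -/
theorem fullMatch_singleton_iff (p q : α) (tl : List α) : fullMatch (p :: tl) [q] = true ↔ p = q := by
  constructor
  · intro h
    by_contra hne
    rw [fullMatch_cons_eq_false_of_ne (tl := tl) (secs := []) hne] at h
    exact Bool.false_ne_true h
  · rintro rfl
    simp [fullMatch, covers]

/-- TWO ONE-TOKEN ALTERNATIVES IN CLOSED FORM. Against `[[q₁], [q₂]]` with `q₁`, `q₂` non-structural, the print `p :: tl` scores: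
structural `p` ⇒ `ABSTAIN_structure`; led by `q₁` or `q₂` ⇒ `AGREE` (whatever rides); led by another head ⇒ `PARTIAL` if `q₁` or
`q₂` rides, else `DISAGREE`. [folklore] -/
theorem outcome_two_singletons (p q₁ q₂ : α) (tl : List α) (h₁ : structural q₁ = false) (h₂ : structural q₂ = false) :
    outcome structural (p :: tl) [[q₁], [q₂]] =
      (if structural p then .ABSTAIN_structure
       else if p = q₁ ∨ p = q₂ then .AGREE
       else if q₁ ∈ tl ∨ q₂ ∈ tl then .PARTIAL else .DISAGREE) := by
  have hexp := expectsStructural_two_singletons structural h₁ h₂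
  have halts : ([[q₁], [q₂]] : List (List α)) ≠ [] := by simp
  by_cases hs : structural p = true
  · rw [if_pos hs]
    exact outcome_structural_abstain structural halts hs hexp
  rw [if_neg hs]
  have hs' : structural p = false := by simpa using hs
  have hgate : (structural p && !expectsStructural structural [[q₁], [q₂]]) = false := by rw [hs']; rfl
  by_cases hp : p = q₁ ∨ p = q₂
  · rw [if_pos hp, outcome_eq_agree_iff structural halts hgate]
    rcases hp with rfl | rfl
    · exact ⟨[p], by simp, (fullMatch_singleton_iff p p tl).2 rfl⟩
    · exact ⟨[p], by simp, (fullMatch_singleton_iff p p tl).2 rfl⟩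
  rw [if_neg hp]
  have hp₁ : p ≠ q₁ := fun h => hp (Or.inl h)
  have hp₂ : p ≠ q₂ := fun h => hp (Or.inr h)
  have hnofull : ∀ a ∈ ([[q₁], [q₂]] : List (List α)), fullMatch (p :: tl) a = false := by
    intro a ha
    simp only [List.mem_cons, List.not_mem_nil, or_false] at ha
    rcases ha with rfl | rfl
    · exact fullMatch_cons_eq_false_of_ne hp₁
    · exact fullMatch_cons_eq_false_of_ne hp₂
  by_cases hm : q₁ ∈ tl ∨ q₂ ∈ tl
  · rw [if_pos hm]
    refine outcome_eq_partial_of structural halts hgate hnofull ?_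
    rcases hm with hm | hm
    · exact ⟨[q₁], by simp, by rw [primaryEmitted_cons']; simp [hm]⟩
    · exact ⟨[q₂], by simp, by rw [primaryEmitted_cons']; simp [hm]⟩
  · rw [if_neg hm]
    refine outcome_eq_disagree_of_no_primary_emitted structural halts hgate ?_
    intro a ha
    simp only [List.mem_cons, List.not_mem_nil, or_false] at ha
    have hm₁ : q₁ ∉ tl := fun h => hm (Or.inl h)
    have hm₂ : q₂ ∉ tl := fun h => hm (Or.inr h)
    have hne₁ : q₁ ≠ p := fun h => hp₁ h.symm
    have hne₂ : q₂ ≠ p := fun h => hp₂ h.symm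
    rcases ha with rfl | rfl
    · rw [primaryEmitted_cons']; simp [hm₁, hne₁]
    · rw [primaryEmitted_cons']; simp [hm₂, hne₂]

/-- … `AGREE` iff the print is LED by one of the two typed heads. [folklore] -/
theorem two_singletons_agree_iff (p q₁ q₂ : α) (tl : List α) (h₁ : structural q₁ = false) (h₂ : structural q₂ = false) :
    outcome structural (p :: tl) [[q₁], [q₂]] = .AGREE ↔ p = q₁ ∨ p = q₂ := by
  rw [outcome_two_singletons structural p q₁ q₂ tl h₁ h₂]
  by_cases hs : structural p = true
  · rw [if_pos hs]; constructor
    · intro h; exact absurd h (by decide)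
    · rintro (rfl | rfl)
      · rw [h₁] at hs; exact absurd hs (by decide)
      · rw [h₂] at hs; exact absurd hs (by decide)
  rw [if_neg hs]
  by_cases hp : p = q₁ ∨ p = q₂
  · rw [if_pos hp]; exact ⟨fun _ => hp, fun _ => rfl⟩
  rw [if_neg hp]
  by_cases hm : q₁ ∈ tl ∨ q₂ ∈ tl
  · rw [if_pos hm]; exact ⟨fun h => absurd h (by decide), fun h => absurd h hp⟩
  · rw [if_neg hm]; exact ⟨fun h => absurd h (by decide), fun h => absurd h hp⟩

end general

open Head

/-! ## §2 The LATTICE TRIPLE on the router's heads -/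

/-- the LATTICE TRIPLE as filed on the organic rows: «1BH ∣ 1BH+UND:LATTICE ∣ UND:LATTICE». [folklore] -/
def latticeTriple : List (List Head) := [[bh1], [bh1, undLattice], [undLattice]]

/-- the two bare primaries it collapses to: «1BH ∣ UND:LATTICE». [folklore] -/
def latticePair : List (List Head) := [[bh1], [undLattice]]

/-- «1BH» dominates «1BH+UND:LATTICE» (same primary, fewer tokens). [folklore] -/
theorem dominates_bh1_bh1Lattice : Dominates [bh1] [bh1, undLattice] :=
  ⟨rfl, fun t ht => by simp only [List.mem_singleton] at ht; subst ht; exact List.mem_cons_self⟩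

/-- THE LATTICE TRIPLE ≡ THE PAIR «1BH ∣ UND:LATTICE» ON EVERY PRINT (the compound middle word is score-inert). [folklore] -/
theorem score_latticeTriple_eq_pair (e : List Head) : score e latticeTriple = score e latticePair := by
  have h1 : score e latticeTriple = score e (latticePair ++ [[bh1, undLattice]]) :=
    outcome_alts_congr Head.structural e (by
      intro a
      simp only [latticeTriple, latticePair, List.cons_append, List.nil_append, List.mem_cons, List.not_mem_nil, or_false]
      tauto)
  rw [h1]
  exact outcome_append_redundant Head.structural e (alts := latticePair) (by simp [latticePair]) dominates_bh1_bh1Lattice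

/-- THE LATTICE TRIPLE IN CLOSED FORM: structural-led ⇒ ABSTAIN(structure); led by «1BH» or «UND:LATTICE» ⇒ AGREE whatever rides;
led by any other head ⇒ PARTIAL iff «1BH» or «UND:LATTICE» rides, else DISAGREE. [folklore] -/
theorem score_latticeTriple (p : Head) (tl : List Head) :
    score (p :: tl) latticeTriple =
      (if p.structural then .ABSTAIN_structure
       else if p = bh1 ∨ p = undLattice then .AGREE
       else if bh1 ∈ tl ∨ undLattice ∈ tl then .PARTIAL else .DISAGREE) := by
  rw [score_latticeTriple_eq_pair]
  exact outcome_two_singletons Head.structural p bh1 undLattice tl rfl rfl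

/-- `AGREE` iff the print is LED by «1BH» or by «UND:LATTICE». [folklore] -/
theorem latticeTriple_agree_iff (p : Head) (tl : List Head) :
    score (p :: tl) latticeTriple = .AGREE ↔ p = bh1 ∨ p = undLattice := by
  rw [score_latticeTriple_eq_pair]
  exact two_singletons_agree_iff Head.structural p bh1 undLattice tl rfl rfl

/-- RIDERS ARE SCORE-INERT BEHIND «1BH»: whatever rides (a «CI» that fires on one conformer only, «EPH», «3BE», a lattice tag,
even a structural token in rider position), a «1BH»-led print is AGREE. [folklore] -/
theorem latticeTriple_bh1_led (tl : List Head) : score (bh1 :: tl) latticeTriple = .AGREE :=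
  (latticeTriple_agree_iff bh1 tl).2 (Or.inl rfl)

/-- … and so is everything behind «UND:LATTICE». [folklore] -/
theorem latticeTriple_lattice_led (tl : List Head) : score (undLattice :: tl) latticeTriple = .AGREE :=
  (latticeTriple_agree_iff undLattice tl).2 (Or.inr rfl)

/-- two «1BH»-led prints that differ only in their riders score the same (the β-(ET)₂I₃ record «1BH» vs its conformer member
«1BH+CI»: «ROUTER-SENSITIVE(conformer) on the rider only» moves no verdict). [folklore] -/
theorem latticeTriple_bh1_riders_immaterial (r₁ r₂ : List Head) :
    score (bh1 :: r₁) latticeTriple = score (bh1 :: r₂) latticeTriple := by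
  rw [latticeTriple_bh1_led, latticeTriple_bh1_led]

/-- a print led by neither typed head is never AGREE — the ceiling behind every pre-named at-risk shape of block54
(r₁ straddle «UND:MIXED», «UND:FLAT», a gap head «CI»/«BI», a k-head «UND:MULTIORB», «EPH»). [folklore] -/
theorem latticeTriple_ne_agree_of_other_head (p : Head) (tl : List Head) (h1 : p ≠ bh1) (h2 : p ≠ undLattice) :
    score (p :: tl) latticeTriple ≠ .AGREE := by
  rw [Ne, latticeTriple_agree_iff]
  rintro (h | h)
  · exact h1 h
  · exact h2 h

/-! ## §3 The instances: block54 (2026-08-30T23:39Z) and the κ-lane precedents of record -/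

/-- The block54 desk table by `decide` (registered at CLAIM stage for M209 α- / M210 β_L- / M211 β_H-(ET)₂I₃, before any number):
«1BH», «1BH+CI», «1BH+UND:LATTICE», «UND:LATTICE», «UND:LATTICE+1BH», «1BH+EPH» ⇒ AGREE; the r₁ straddle / FLAT / gap / k-head /
«3BE» shapes WITH «1BH» riding ⇒ PARTIAL; the same heads rider-less and a bare «EPH» ⇒ DISAGREE; a structure-LED print ⇒
ABSTAIN(structure) — and a structural token RIDING behind «1BH» is still AGREE. [folklore] -/
theorem block54_table :
    score [bh1] latticeTriple = .AGREE ∧ score [bh1, ci] latticeTriple = .AGREE ∧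
    score [bh1, undLattice] latticeTriple = .AGREE ∧ score [undLattice] latticeTriple = .AGREE ∧
    score [undLattice, bh1] latticeTriple = .AGREE ∧ score [bh1, eph] latticeTriple = .AGREE ∧
    score [bh1, undLattice, ci] latticeTriple = .AGREE ∧ score [bh1, undStruct] latticeTriple = .AGREE ∧
    score [undMixed, bh1] latticeTriple = .PARTIAL ∧ score [undFlat, bh1] latticeTriple = .PARTIAL ∧
    score [ci, bh1] latticeTriple = .PARTIAL ∧ score [undMultiorb, bh1] latticeTriple = .PARTIAL ∧
    score [be3, bh1] latticeTriple = .PARTIAL ∧ score [undHF, bh1] latticeTriple = .PARTIAL ∧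
    score [undMixed] latticeTriple = .DISAGREE ∧ score [undFlat] latticeTriple = .DISAGREE ∧
    score [ci] latticeTriple = .DISAGREE ∧ score [bi] latticeTriple = .DISAGREE ∧
    score [eph] latticeTriple = .DISAGREE ∧ score [undMultiorb] latticeTriple = .DISAGREE ∧
    score [undStruct, bh1] latticeTriple = .ABSTAIN_structure ∧ score [undDisputed, bh1] latticeTriple = .ABSTAIN_structure := by
  decide

/-- The κ-lane precedents of record under the same typing (WORDS rows 389–394 / 471–472 / 566): M120 κ-NCS «1BH» @0 / @0.6,
M46 κ-CN «1BH+CI» @0 / @0.4 / @0.8, M213 κ-(ET)₂I₃ «1BH» @0 — every one AGREE; and the β-(ET)₂I₃ conformer pair of 2026-08-30T23:59Z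
(record «1BH» after the R-aax re-key, member «1BH+CI») reads AGREE / AGREE. [folklore] -/
theorem kappa_lane_precedents :
    score [bh1] latticeTriple = .AGREE ∧ score [bh1, ci] latticeTriple = .AGREE ∧
    score [bh1] latticeTriple = score [bh1, ci] latticeTriple := by
  refine ⟨by decide, by decide, latticeTriple_bh1_riders_immaterial [] [ci]⟩


/-! ## §4 (append, g23 2026-08-31T01:0xZ) A second instance of §1: the TETRADYMITE TRIPLE «EPH ∣ EPH+UND:STRUCT ∣ BI» ≡ «EPH ∣ BI»
(M324 Bi₂Se₃ / M325 Bi₂Te₃ / M326 Sb₂Te₃; score-2 block55, run-6 g18 PREREG + CLAIM rows 8 / 1, lead g38 R-aay — filed BEFORE the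
@4.0 / @2.3 P-column words)

The tetradymite trio is typed `['EPH', 'EPH+UND:STRUCT', 'BI']`: the STRUCTPAIR of p754634 plus the band-insulator word «BI». The middle
word is dominated by «EPH», so the triple scores every print like the two bare primaries «EPH ∣ BI» — again an instance of
`outcome_two_singletons`. Consequence said before the numbers (block55 and the lead's R-aay CORRECTION TO LETTER (1)): on the Sb₂Te₃ @4.0
column BOTH branches of the run seat's decision rule R-lr (ii) — «BI» (no spinor crossing) or «EPH» (a crossing) — are AGREE for the
router-word score; the score has no status argument at all (`score e alts`), so «an insulator word on a superconducting column» is a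
phase-map-cell tension the §4.2 letter cannot see. -/

/-- the TETRADYMITE TRIPLE as filed on M324 / M325 / M326: «EPH ∣ EPH+UND:STRUCT ∣ BI». [folklore] -/
def tetradymiteTriple : List (List Head) := [[eph], [eph, undStruct], [bi]]

/-- the two bare primaries it collapses to: «EPH ∣ BI». [folklore] -/
def ephBiPair : List (List Head) := [[eph], [bi]]

/-- THE TETRADYMITE TRIPLE ≡ THE PAIR «EPH ∣ BI» ON EVERY PRINT (the «+UND:STRUCT» word is score-inert, as in `score_structpair_eq_ephOnly`).
[folklore] -/
theorem score_tetradymiteTriple_eq_pair (e : List Head) : score e tetradymiteTriple = score e ephBiPair := by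
  have h1 : score e tetradymiteTriple = score e (ephBiPair ++ [[eph, undStruct]]) :=
    outcome_alts_congr Head.structural e (by
      intro a
      simp only [tetradymiteTriple, ephBiPair, List.cons_append, List.nil_append, List.mem_cons, List.not_mem_nil, or_false]
      tauto)
  rw [h1]
  exact outcome_append_redundant Head.structural e (alts := ephBiPair) (by simp [ephBiPair]) dominates_eph_ephStruct

/-- THE TETRADYMITE TRIPLE IN CLOSED FORM: structural-led ⇒ ABSTAIN(structure) (the registered shape for the input-gated high-P columns);
led by «EPH» or «BI» ⇒ AGREE whatever rides; any other head ⇒ PARTIAL iff «EPH» or «BI» rides, else DISAGREE. [folklore] -/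
theorem score_tetradymiteTriple (p : Head) (tl : List Head) :
    score (p :: tl) tetradymiteTriple =
      (if p.structural then .ABSTAIN_structure
       else if p = eph ∨ p = bi then .AGREE
       else if eph ∈ tl ∨ bi ∈ tl then .PARTIAL else .DISAGREE) := by
  rw [score_tetradymiteTriple_eq_pair]
  exact outcome_two_singletons Head.structural p eph bi tl rfl rfl

/-- `AGREE` iff the print is LED by «EPH» or by «BI» — so both branches of R-lr (ii) on Sb₂Te₃ @4.0 are AGREE. [folklore] -/
theorem tetradymiteTriple_agree_iff (p : Head) (tl : List Head) :
    score (p :: tl) tetradymiteTriple = .AGREE ↔ p = eph ∨ p = bi := by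
  rw [score_tetradymiteTriple_eq_pair]
  exact two_singletons_agree_iff Head.structural p eph bi tl rfl rfl

/-- R-lr (ii) IS VERDICT-IMMUNE: the «BI» branch and the «EPH» branch score the same, whatever rides behind either. [folklore] -/
theorem tetradymite_rlr_branches_agree (r₁ r₂ : List Head) :
    score (bi :: r₁) tetradymiteTriple = .AGREE ∧ score (eph :: r₂) tetradymiteTriple = .AGREE :=
  ⟨(tetradymiteTriple_agree_iff bi r₁).2 (Or.inr rfl), (tetradymiteTriple_agree_iff eph r₂).2 (Or.inl rfl)⟩

/-- The block55 desk table by `decide` (registered at CLAIM stage for M326 @4.0 / M324 @2.3, before any number; ≡ the words of record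
@0 ×2 / @3): «BI», «BI+EPH», «EPH», «EPH+UND:STRUCT», «EPH+SA» ⇒ AGREE; «UND:MIXED+EPH» ⇒ PARTIAL; «CI» ⇒ DISAGREE; «UND:STRUCT»-led
(+EPH or +BI) ⇒ ABSTAIN(structure). [folklore] -/
theorem block55_table :
    score [bi] tetradymiteTriple = .AGREE ∧ score [bi, eph] tetradymiteTriple = .AGREE ∧ score [eph] tetradymiteTriple = .AGREE ∧
    score [eph, undStruct] tetradymiteTriple = .AGREE ∧ score [eph, sa] tetradymiteTriple = .AGREE ∧
    score [undMixed, eph] tetradymiteTriple = .PARTIAL ∧ score [ci] tetradymiteTriple = .DISAGREE ∧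
    score [undStruct, eph] tetradymiteTriple = .ABSTAIN_structure ∧ score [undStruct, bi] tetradymiteTriple = .ABSTAIN_structure := by
  decide

end RouterScore

end Summit.Ventures.CertifiedManyBodySolver.Downfold
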